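import Mathlib.Analysis.SpecialFunctions.Log.Base
import Literature.Barriers.MatrixMultiplication.RectangularBarrier
import Literature.Barriers.MatrixMultiplication.UniversalMethodBarrierCwCore
import Literature.Computability.AlgebraicComplexity.SupportFunctionalPowers
import Literature.Computability.AlgebraicComplexity.SupportEntropy
import Literature.Computability.AlgebraicComplexity.BigCoppersmithWinograd
import HarnessLib

/-!
# The CLLZ barrier chain for a fixed intermediate tensor with the upper support functionals, proved

Topic `Literature/Barriers/MatrixMultiplication`; support file for the discharge of the numerical
facts `CLLZ2025_alpha_barrier_CW` and `CLLZ2025_omegaTwo_barrier_CW` of `RectangularBarrier.lean`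
(Christandl–Le Gall–Lysikov–Zuiddam, *Barriers for rectangular matrix multiplication*, comput.
complexity 34 (2025) = arXiv:2003.03019, Thm. 3.10/3.15, Thm. 3.22, §4.1 eq. (5), §4.3–4.4).

The file `RectangularBarrier.lean` proves the barrier for every *adequate* `F` (`IsAdequate.barrier`),
and adequacy of Strassen's `ζ^θ` needs the whole of Strassen's theorem (monotonicity, additivity),
which the tree vendors as a named fact. Here the barrier chain for `F = ζ^θ` is PROVED directly from
the two halves of Strassen's theory that are proved in the tree:

* the lower bound `H_θ(P) ≤ ρ^θ(T^{⊗k})` for every probability distribution `P` on the support of an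
  oblique restriction `u` of `T^{⊗k}` (`weightedEntropy_le_mul_of_kroneckerPow_restrictsTo`,
  `SupportFunctionalPowers.lean` with `SupportFunctionalRestriction.lean`: CVZ Prop. 2.16 along
  restrictions, Strassen's ordering lemma, sub-multiplicativity over Kronecker powers), applied to
  `u = ⟨s⟩ ⊗ ⟨n,n,m⟩` — whose standard support is an antichain (it is tight) carrying the uniform
  distribution with uniform marginals (`uniform_unitMatMul_spec`, this file) — which yields
  `log₂ s + (1 + θ₁) log₂ n + (1 − θ₁) log₂ m ≤ k · H_θ(supp T)` for every reduction
  `T^{⊗k} ≥ ⟨s⟩ ⊗ ⟨n,n,m⟩` (tree's index convention for `⟨n,n,m⟩ = matMulTensor K n n m`);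
* an upper bound `H_θ(supp T) ≤ h` in the standard bases (weak duality,
  `maxWeightedEntropy_le_of_cost_le`, `SupportEntropy.lean`), here specialised to the six orbit types
  of `supp CW_q` (`maxWeightedEntropy_bigCw_le_of_costs`), and a lower bound `R₀ ≤ R̃(T)` with
  `2^h ≤ R₀` (for `CW_q`: `R₀ = q + 2`, `le_asymptoticRank_bigCwTensor`).

Main results (all proved): `tMethodBound_ge_of_maxWeightedEntropy_le` — every `T`-method bound `ω̂` on
`ω(p)` (`IsTMethodBound`) satisfies `ω̂ ≥ (log₂ R₀ / h) · ((1 + θ 1) + p (1 − θ 1))` (CLLZ Thm. 3.15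
with eq. (5), the catalytic term dropped); `alpha_le_of_maxWeightedEntropy_le` — every `T`-method lower
bound `p` on `α` (`IsTMethodAlphaBound`) satisfies `p ≤ (2h / log₂ R₀ − (1 + θ 1)) / (1 − θ 1)`
(CLLZ Thm. 3.22, §4.3); and their `CW_q` forms `omegaHat_bigCw_ge_of_costs`, `alpha_bigCw_le_of_costs`
taking the six cost inequalities of a dual certificate as hypotheses. The inline tensor of the facts in
`RectangularBarrier.lean` is `bigCwTensor K q` (`IrreversibilityBarrier.lean`) by `rfl`.
-/

noncomputable section

open scoped BigOperators

namespace Literature.Barriers.MatrixMultiplication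

open Literature.Computability.AlgebraicComplexity

/-! ## The oblique tensor `⟨s⟩ ⊗ ⟨a,b,c⟩` and the uniform distribution on its support -/

section UnitMatMul

variable (K : Type*) [Field K]

/-- The support of `⟨s⟩ ⊗ ⟨a,b,c⟩` in the standard bases: `{((σ,(i,k)),(σ,(i,j)),(σ,(j,k)))}`.
[folklore] -/
theorem mem_tensorSupport_unitMatMul {s a b c : ℕ}
    (x : (Fin s × (Fin a × Fin c)) × (Fin s × (Fin a × Fin b)) × (Fin s × (Fin b × Fin c))) :
    x ∈ tensorSupport (kroneckerTensor (unitTensor K s) (matMulTensor K a b c)) ↔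
      (x.1.1 = x.2.1.1 ∧ x.2.1.1 = x.2.2.1) ∧
        (x.1.2.1 = x.2.1.2.1 ∧ x.2.1.2.2 = x.2.2.2.1 ∧ x.1.2.2 = x.2.2.2.2) := by
  simp only [mem_tensorSupport, kroneckerTensor_apply, unitTensor_apply, matMulTensor, mul_ne_zero_iff,
    ne_eq, ite_eq_right_iff, one_ne_zero, imp_false, not_not]

/-- **The support of `⟨s⟩ ⊗ ⟨a,b,c⟩` is an antichain** for the lexicographic orders `(σ, k, i)`,
`(σ, j, -i)`, `(-σ, -j, -k)` on the three index sets (it is tight: the block index `σ` gets the weights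
`(1, 1, -2)` on top of the tight labelling of `⟨a,b,c⟩`, BCS Rem. 15.35(3)). [folklore] -/
theorem unitMatMul_support_antichain (s a b c : ℕ) :
    ∀ x ∈ tensorSupport (kroneckerTensor (unitTensor K s) (matMulTensor K a b c)),
    ∀ y ∈ tensorSupport (kroneckerTensor (unitTensor K s) (matMulTensor K a b c)),
      toLex ((x.1.1 : ℕ), toLex ((x.1.2.2 : ℕ), (x.1.2.1 : ℕ))) ≤
        toLex ((y.1.1 : ℕ), toLex ((y.1.2.2 : ℕ), (y.1.2.1 : ℕ))) →
      toLex ((x.2.1.1 : ℕ), toLex ((x.2.1.2.2 : ℕ), (x.2.1.2.1.rev : ℕ))) ≤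
        toLex ((y.2.1.1 : ℕ), toLex ((y.2.1.2.2 : ℕ), (y.2.1.2.1.rev : ℕ))) →
      toLex ((x.2.2.1.rev : ℕ), toLex ((x.2.2.2.1.rev : ℕ), (x.2.2.2.2.rev : ℕ))) ≤
        toLex ((y.2.2.1.rev : ℕ), toLex ((y.2.2.2.1.rev : ℕ), (y.2.2.2.2.rev : ℕ))) →
        y = x := by
  rintro ⟨⟨σ, i, k⟩, ⟨σ₁, i₁, j⟩, ⟨σ₂, j₁, k₁⟩⟩ hx ⟨⟨σ', i', k'⟩, ⟨σ₁', i₁', j'⟩, ⟨σ₂', j₁', k₁'⟩⟩ hy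
    h₁ h₂ h₃
  simp only [mem_tensorSupport_unitMatMul] at hx hy
  obtain ⟨⟨rfl, rfl⟩, rfl, rfl, rfl⟩ := hx
  obtain ⟨⟨rfl, rfl⟩, rfl, rfl, rfl⟩ := hy
  simp only [Prod.Lex.le_iff, ofLex_toLex, Fin.val_rev] at h₁ h₂ h₃
  have hσ := σ.isLt
  have hσ' := σ'.isLt
  have hi := i.isLt
  have hi' := i'.isLt
  have hj := j.isLt
  have hj' := j'.isLt
  have hk := k.isLt
  have hk' := k'.isLt
  have eσ : (σ : ℕ) = σ' := by omega
  have ej : (j : ℕ) = j' := by omega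
  have ek : (k : ℕ) = k' := by omega
  have ei : (i : ℕ) = i' := by omega
  simp only [Prod.mk.injEq]
  exact ⟨⟨(Fin.ext eσ).symm, (Fin.ext ei).symm, (Fin.ext ek).symm⟩,
    ⟨(Fin.ext eσ).symm, (Fin.ext ei).symm, (Fin.ext ej).symm⟩,
    (Fin.ext eσ).symm, (Fin.ext ej).symm, (Fin.ext ek).symm⟩

/-- The lexicographic weights are injective (first factor). [folklore] -/
theorem injective_unitMatMulWeight₁ (s a c : ℕ) :
    Function.Injective fun x : Fin s × (Fin a × Fin c) =>
      toLex ((x.1 : ℕ), toLex ((x.2.2 : ℕ), (x.2.1 : ℕ))) := by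
  rintro ⟨σ, i, k⟩ ⟨σ', i', k'⟩ h
  simp only [EmbeddingLike.apply_eq_iff_eq, Prod.mk.injEq] at h
  obtain ⟨h1, h2, h3⟩ := h
  exact Prod.ext (Fin.ext h1) (Prod.ext (Fin.ext h3) (Fin.ext h2))

/-- The lexicographic weights are injective (second factor). [folklore] -/
theorem injective_unitMatMulWeight₂ (s a b : ℕ) :
    Function.Injective fun x : Fin s × (Fin a × Fin b) =>
      toLex ((x.1 : ℕ), toLex ((x.2.2 : ℕ), (x.2.1.rev : ℕ))) := by
  rintro ⟨σ, i, j⟩ ⟨σ', i', j'⟩ h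
  simp only [EmbeddingLike.apply_eq_iff_eq, Prod.mk.injEq] at h
  obtain ⟨h1, h2, h3⟩ := h
  exact Prod.ext (Fin.ext h1) (Prod.ext (Fin.rev_injective (Fin.ext h3)) (Fin.ext h2))

/-- The lexicographic weights are injective (third factor). [folklore] -/
theorem injective_unitMatMulWeight₃ (s b c : ℕ) :
    Function.Injective fun x : Fin s × (Fin b × Fin c) =>
      toLex ((x.1.rev : ℕ), toLex ((x.2.1.rev : ℕ), (x.2.2.rev : ℕ))) := by
  rintro ⟨σ, j, k⟩ ⟨σ', j', k'⟩ h
  simp only [EmbeddingLike.apply_eq_iff_eq, Prod.mk.injEq] at h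
  obtain ⟨h1, h2, h3⟩ := h
  exact Prod.ext (Fin.rev_injective (Fin.ext h1))
    (Prod.ext (Fin.rev_injective (Fin.ext h2)) (Fin.rev_injective (Fin.ext h3)))

variable {K}

/-- The uniform distribution on `supp (⟨s⟩ ⊗ ⟨a,b,c⟩)`, written as `s⁻¹` times the uniform
distribution on `supp ⟨a,b,c⟩` on each diagonal block: first marginal `= 1/(sac)`. [folklore] -/
theorem marginalDist₁_uniform_unitMatMul {s a b c : ℕ} (ha : 1 ≤ a) (hb : 1 ≤ b) (hc : 1 ≤ c)
    (x : Fin s × (Fin a × Fin c)) :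
    marginalDist₁ (fun y : (Fin s × (Fin a × Fin c)) × (Fin s × (Fin a × Fin b)) ×
        (Fin s × (Fin b × Fin c)) =>
      if y.1.1 = y.2.1.1 ∧ y.2.1.1 = y.2.2.1 then (s : ℝ)⁻¹ *
        (if y.1.2.1 = y.2.1.2.1 ∧ y.2.1.2.2 = y.2.2.2.1 ∧ y.1.2.2 = y.2.2.2.2 then
          ((a * b * c : ℕ) : ℝ)⁻¹ else 0) else 0) x = (s : ℝ)⁻¹ * ((a * c : ℕ) : ℝ)⁻¹ := by
  obtain ⟨σ, p⟩ := x
  rw [← marginalDist₁_uniform_matMul ha hb hc p]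
  simp only [marginalDist₁]
  conv_lhs => rw [Fintype.sum_prod_type]
  rw [Finset.mul_sum]
  refine Finset.sum_eq_single_of_mem σ (Finset.mem_univ _) (fun σ₂ _ hσ₂ => ?_) |>.trans ?_
  · refine Finset.sum_eq_zero fun q' _ => Finset.sum_eq_zero fun γ _ => ?_
    rw [if_neg]
    rintro ⟨h, -⟩
    exact hσ₂ h.symm
  · refine Finset.sum_congr rfl fun q' _ => ?_
    conv_lhs => rw [Fintype.sum_prod_type]
    rw [Finset.mul_sum]
    refine Finset.sum_eq_single_of_mem σ (Finset.mem_univ _) (fun σ₃ _ hσ₃ => ?_) |>.trans ?_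
    · refine Finset.sum_eq_zero fun r _ => ?_
      rw [if_neg]
      rintro ⟨-, h⟩
      exact hσ₃ h.symm
    · refine Finset.sum_congr rfl fun r _ => ?_
      rw [if_pos ⟨rfl, rfl⟩]

/-- Second marginal of the uniform distribution on `supp (⟨s⟩ ⊗ ⟨a,b,c⟩)`: `= 1/(sab)`. [folklore] -/
theorem marginalDist₂_uniform_unitMatMul {s a b c : ℕ} (ha : 1 ≤ a) (hb : 1 ≤ b) (hc : 1 ≤ c)
    (x : Fin s × (Fin a × Fin b)) :
    marginalDist₂ (fun y : (Fin s × (Fin a × Fin c)) × (Fin s × (Fin a × Fin b)) ×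
        (Fin s × (Fin b × Fin c)) =>
      if y.1.1 = y.2.1.1 ∧ y.2.1.1 = y.2.2.1 then (s : ℝ)⁻¹ *
        (if y.1.2.1 = y.2.1.2.1 ∧ y.2.1.2.2 = y.2.2.2.1 ∧ y.1.2.2 = y.2.2.2.2 then
          ((a * b * c : ℕ) : ℝ)⁻¹ else 0) else 0) x = (s : ℝ)⁻¹ * ((a * b : ℕ) : ℝ)⁻¹ := by
  obtain ⟨σ, q'⟩ := x
  rw [← marginalDist₂_uniform_matMul ha hb hc q']
  simp only [marginalDist₂]
  conv_lhs => rw [Fintype.sum_prod_type]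
  rw [Finset.mul_sum]
  refine Finset.sum_eq_single_of_mem σ (Finset.mem_univ _) (fun σ₁ _ hσ₁ => ?_) |>.trans ?_
  · refine Finset.sum_eq_zero fun p _ => Finset.sum_eq_zero fun γ _ => ?_
    rw [if_neg]
    rintro ⟨h, -⟩
    exact hσ₁ h
  · refine Finset.sum_congr rfl fun p _ => ?_
    conv_lhs => rw [Fintype.sum_prod_type]
    rw [Finset.mul_sum]
    refine Finset.sum_eq_single_of_mem σ (Finset.mem_univ _) (fun σ₃ _ hσ₃ => ?_) |>.trans ?_
    · refine Finset.sum_eq_zero fun r _ => ?_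
      rw [if_neg]
      rintro ⟨-, h⟩
      exact hσ₃ h.symm
    · refine Finset.sum_congr rfl fun r _ => ?_
      rw [if_pos ⟨rfl, rfl⟩]

/-- Third marginal of the uniform distribution on `supp (⟨s⟩ ⊗ ⟨a,b,c⟩)`: `= 1/(sbc)`. [folklore] -/
theorem marginalDist₃_uniform_unitMatMul {s a b c : ℕ} (ha : 1 ≤ a) (hb : 1 ≤ b) (hc : 1 ≤ c)
    (x : Fin s × (Fin b × Fin c)) :
    marginalDist₃ (fun y : (Fin s × (Fin a × Fin c)) × (Fin s × (Fin a × Fin b)) ×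
        (Fin s × (Fin b × Fin c)) =>
      if y.1.1 = y.2.1.1 ∧ y.2.1.1 = y.2.2.1 then (s : ℝ)⁻¹ *
        (if y.1.2.1 = y.2.1.2.1 ∧ y.2.1.2.2 = y.2.2.2.1 ∧ y.1.2.2 = y.2.2.2.2 then
          ((a * b * c : ℕ) : ℝ)⁻¹ else 0) else 0) x = (s : ℝ)⁻¹ * ((b * c : ℕ) : ℝ)⁻¹ := by
  obtain ⟨σ, r⟩ := x
  rw [← marginalDist₃_uniform_matMul ha hb hc r]
  simp only [marginalDist₃]
  conv_lhs => rw [Fintype.sum_prod_type]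
  rw [Finset.mul_sum]
  refine Finset.sum_eq_single_of_mem σ (Finset.mem_univ _) (fun σ₁ _ hσ₁ => ?_) |>.trans ?_
  · refine Finset.sum_eq_zero fun p _ => Finset.sum_eq_zero fun β _ => ?_
    rw [if_neg]
    rintro ⟨h1, h2⟩
    exact hσ₁ (h1.trans h2)
  · refine Finset.sum_congr rfl fun p _ => ?_
    conv_lhs => rw [Fintype.sum_prod_type]
    rw [Finset.mul_sum]
    refine Finset.sum_eq_single_of_mem σ (Finset.mem_univ _) (fun σ₂ _ hσ₂ => ?_) |>.trans ?_
    · refine Finset.sum_eq_zero fun q' _ => ?_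
      rw [if_neg]
      rintro ⟨-, h⟩
      exact hσ₂ h
    · refine Finset.sum_congr rfl fun q' _ => ?_
      rw [if_pos ⟨rfl, rfl⟩]

/-- **The uniform distribution on `supp (⟨s⟩ ⊗ ⟨a,b,c⟩)`** (`s, a, b, c ≥ 1`) is a probability
distribution supported in the support, with uniform marginals and hence
`H_θ = θ 0 · log₂(sac) + θ 1 · log₂(sab) + θ 2 · log₂(sbc)`. [folklore] -/
theorem uniform_unitMatMul_spec {s a b c : ℕ} (hs : 1 ≤ s) (ha : 1 ≤ a) (hb : 1 ≤ b) (hc : 1 ≤ c)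
    (θ : Fin 3 → ℝ) :
    let P₀ : (Fin s × (Fin a × Fin c)) × (Fin s × (Fin a × Fin b)) × (Fin s × (Fin b × Fin c)) → ℝ :=
      fun y => if y.1.1 = y.2.1.1 ∧ y.2.1.1 = y.2.2.1 then (s : ℝ)⁻¹ *
        (if y.1.2.1 = y.2.1.2.1 ∧ y.2.1.2.2 = y.2.2.2.1 ∧ y.1.2.2 = y.2.2.2.2 then
          ((a * b * c : ℕ) : ℝ)⁻¹ else 0) else 0
    P₀ ∈ stdSimplex ℝ ((Fin s × (Fin a × Fin c)) × (Fin s × (Fin a × Fin b)) ×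
        (Fin s × (Fin b × Fin c))) ∧
      Function.support P₀ ⊆ tensorSupport (kroneckerTensor (unitTensor K s) (matMulTensor K a b c)) ∧
      weightedEntropy θ P₀ = θ 0 * (Real.log (s * (a * c)) / Real.log 2) +
        θ 1 * (Real.log (s * (a * b)) / Real.log 2) + θ 2 * (Real.log (s * (b * c)) / Real.log 2) := by
  intro P₀
  have hs0 : (s : ℝ) ≠ 0 := by exact_mod_cast (by omega : s ≠ 0)
  have hm₁ : marginalDist₁ P₀ = fun _ => ((s * (a * c) : ℕ) : ℝ)⁻¹ := by
    funext x
    rw [marginalDist₁_uniform_unitMatMul ha hb hc x]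
    push_cast
    rw [← mul_inv]
  have hm₂ : marginalDist₂ P₀ = fun _ => ((s * (a * b) : ℕ) : ℝ)⁻¹ := by
    funext x
    rw [marginalDist₂_uniform_unitMatMul ha hb hc x]
    push_cast
    rw [← mul_inv]
  have hm₃ : marginalDist₃ P₀ = fun _ => ((s * (b * c) : ℕ) : ℝ)⁻¹ := by
    funext x
    rw [marginalDist₃_uniform_unitMatMul ha hb hc x]
    push_cast
    rw [← mul_inv]
  refine ⟨⟨fun y => ?_, ?_⟩, fun y hy => ?_, ?_⟩
  · simp only [P₀]
    split_ifs <;> positivity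
  · have e : ∑ y, P₀ y = ∑ x, marginalDist₁ P₀ x := by
      simp only [marginalDist₁, Fintype.sum_prod_type]
    rw [e, hm₁, Finset.sum_const, Finset.card_univ, Fintype.card_prod, Fintype.card_prod,
      Fintype.card_fin, Fintype.card_fin, Fintype.card_fin, nsmul_eq_mul]
    have : ((s * (a * c) : ℕ) : ℝ) ≠ 0 := by
      exact_mod_cast Nat.mul_ne_zero (by omega) (Nat.mul_ne_zero (by omega) (by omega))
    exact mul_inv_cancel₀ this
  · rw [Function.mem_support] at hy
    rw [mem_tensorSupport_unitMatMul]
    by_contra h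
    rw [not_and_or] at h
    rcases h with h | h
    · exact hy (if_neg h)
    · apply hy
      simp only [P₀]
      rw [if_neg h, mul_zero, ite_self]
  · simp only [weightedEntropy, hm₁, hm₂, hm₃]
    rw [shannonEntropy_const_inv_card (by simp), shannonEntropy_const_inv_card (by simp),
      shannonEntropy_const_inv_card (by simp)]
    push_cast
    ring

/-- **Lower bound from a reduction.** If `T^{⊗k} ≥ ⟨s⟩ ⊗ ⟨a,b,c⟩` (restriction; `s, a, b, c ≥ 1`) then
for every `θ ≥ 0`,
`θ 0 · log₂(sac) + θ 1 · log₂(sab) + θ 2 · log₂(sbc) ≤ k · H_θ(supp T)` — Strassen's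
`ζ^θ(⟨s⟩ ⊗ ⟨a,b,c⟩) ≤ ζ^θ(T)^k` evaluated by Lemma 4.1 (the `F`-chain of CLLZ Thm. 3.10 for `F = ζ^θ`,
with `ζ^θ(T)` replaced by its standard-basis bound `2^{H_θ(supp T)}`).
[cite: ChristandlLeGallLysikovZuiddam2025, Thm. 3.10 (proof)] -/
theorem weighted_log_le_of_kroneckerPow_restrictsTo_unitMatMul {ι κ μ : Type*} [Fintype ι]
    [Fintype κ] [Fintype μ] [DecidableEq ι] [DecidableEq κ] [DecidableEq μ] {θ : Fin 3 → ℝ}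
    (hθ : ∀ i, 0 ≤ θ i) (T : ι → κ → μ → K) (k : ℕ) {s a b c : ℕ} (hs : 1 ≤ s) (ha : 1 ≤ a)
    (hb : 1 ≤ b) (hc : 1 ≤ c)
    (hred : TensorRestrictsTo (kroneckerPow T k)
      (kroneckerTensor (unitTensor K s) (matMulTensor K a b c))) :
    θ 0 * (Real.log (s * (a * c)) / Real.log 2) + θ 1 * (Real.log (s * (a * b)) / Real.log 2) +
        θ 2 * (Real.log (s * (b * c)) / Real.log 2) ≤
      k * maxWeightedEntropy θ (tensorSupport T) := by
  classical
  obtain ⟨hP₀, hsupp, hval⟩ := uniform_unitMatMul_spec (K := K) hs ha hb hc θ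
  rw [← hval]
  exact weightedEntropy_le_mul_of_kroneckerPow_restrictsTo hθ T k _ hred _ _ _
    (injective_unitMatMulWeight₁ s a c) (injective_unitMatMulWeight₂ s a b)
    (injective_unitMatMulWeight₃ s b c) (unitMatMul_support_antichain K s a b c) hP₀ hsupp

end UnitMatMul

/-! ## The barrier chain for a fixed intermediate tensor -/

section Chain

variable {K : Type} [Field K] {ι κ μ : Type} [Fintype ι] [Fintype κ] [Fintype μ]
variable [DecidableEq ι] [DecidableEq κ] [DecidableEq μ]

/-- **CLLZ Thm. 3.15 with eq. (5) for `F = ζ^θ`, proved from a standard-basis certificate.** Let `T` be a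
tensor, `θ ∈ P([3])`, `H_θ(supp T) ≤ h` with `h > 0`, and `2^h ≤ R₀ ≤ R̃(T)`. Then every upper bound
`ω̂` on `ω(p)` obtained by a `T`-method (`IsTMethodBound`) satisfies
`ω̂ ≥ (log₂ R₀ / h) · ((1 + θ 1) + p · (1 − θ 1))` (tree's index convention; printed
`(2θ₁ + θ₂ + θ₃ + p(θ₂ + θ₃)) log R̃(T) / log ζ^θ(T)`). For each reduction
`T^{⊗k} ≥ ⟨s⟩ ⊗ ⟨n,n,m⟩`, `log₂ s + (1+θ 1) log₂ n + (1−θ 1) log₂ m ≤ k h`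
(`weighted_log_le_of_kroneckerPow_restrictsTo_unitMatMul`), while the method certifies only
`k log_n r − log_n s` with `r ≥ R̃(T) ≥ R₀ ≥ 2^h`; eliminating `k` and letting `ε → 0`.
[cite: ChristandlLeGallLysikovZuiddam2025, Thm. 3.15 and §4.1 (eq. (5))] -/
theorem tMethodBound_ge_of_maxWeightedEntropy_le {T : ι → κ → μ → K} {θ : Fin 3 → ℝ}
    (hθ : θ ∈ stdSimplex ℝ (Fin 3)) {h R₀ : ℝ} (h0 : 0 < h)
    (hh : maxWeightedEntropy θ (tensorSupport T) ≤ h) (hR₀ : (2 : ℝ) ^ h ≤ R₀)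
    (hR : R₀ ≤ asymptoticRank T) {p ω : ℝ} (hb : IsTMethodBound K T p ω) :
    Real.logb 2 R₀ / h * ((1 + θ 1) + p * (1 - θ 1)) ≤ ω := by
  classical
  obtain ⟨r, hr, H⟩ := hb
  have hθ0 := hθ.1
  have hsum : θ 0 + θ 1 + θ 2 = 1 := by simpa [Fin.sum_univ_three] using hθ.2
  have hθ1 : θ 1 ≤ 1 := by linarith [hθ0 0, hθ0 2]
  set L := Real.log 2 with hL
  have hL0 : 0 < L := Real.log_pos one_lt_two
  have h2h : 1 < (2 : ℝ) ^ h := Real.one_lt_rpow one_lt_two h0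
  have hR₀1 : 1 < R₀ := h2h.trans_le hR₀
  have hr1 : 1 < r := hR₀1.trans_le (hR.trans hr)
  have hlogR₀ : h * L ≤ Real.log R₀ := by
    have := Real.log_le_log (by positivity) hR₀
    rwa [Real.log_rpow two_pos] at this
  have hlogr : Real.log R₀ ≤ Real.log r := Real.log_le_log (by linarith) (hR.trans hr)
  -- `ρ₀ = log₂ R₀ / h ≥ 1` and `ρ = log r / (h L) ≥ ρ₀`
  set ρ₀ := Real.logb 2 R₀ / h with hρ₀
  have hρ₀' : ρ₀ = Real.log R₀ / (h * L) := by
    rw [hρ₀, Real.logb, div_div, mul_comm]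
  have hρ₀1 : 1 ≤ ρ₀ := by
    rw [hρ₀', le_div_iff₀ (by positivity)]
    linarith
  set ρ := Real.log r / (h * L) with hρ
  have hρρ₀ : ρ₀ ≤ ρ := by
    rw [hρ₀', hρ]
    exact div_le_div_of_nonneg_right hlogr (by positivity)
  have hρ1 : 1 ≤ ρ := hρ₀1.trans hρρ₀
  -- one `ε`
  have main : ∀ ε : ℝ, 0 < ε → ρ₀ * ((1 + θ 1) + (p - ε) * (1 - θ 1)) ≤ ω + ε := by
    intro ε hε
    obtain ⟨k, n, m, s, hn, hs, hm, hred, hbd⟩ := H ε hε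
    have hn1 : (1 : ℝ) < n := by exact_mod_cast (by omega : 1 < n)
    have hn0 : (0 : ℝ) < n := by linarith
    have hlogn : 0 < Real.log n := Real.log_pos hn1
    have hnp : 0 < (n : ℝ) ^ (p - ε) := Real.rpow_pos_of_pos hn0 _
    have hm0 : (0 : ℝ) < m := hnp.trans_le hm
    have hm1 : 1 ≤ m := by exact_mod_cast (show (0 : ℝ) < m from hm0)
    have hs0 : (0 : ℝ) < s := by exact_mod_cast (by omega : 0 < s)
    have hlogm : (p - ε) * Real.log n ≤ Real.log m := by
      have := Real.log_le_log hnp hm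
      rwa [Real.log_rpow hn0] at this
    have hlogs : 0 ≤ Real.log s := Real.log_nonneg (by exact_mod_cast hs)
    have hlogm0 : 0 ≤ Real.log m := Real.log_nonneg (by exact_mod_cast hm1)
    -- the certificate inequality for this reduction
    have hcert := weighted_log_le_of_kroneckerPow_restrictsTo_unitMatMul (K := K) hθ0 T k hs
      (by omega) (by omega) hm1 hred
    have hkh : θ 0 * (Real.log (s * (n * m)) / L) + θ 1 * (Real.log (s * (n * n)) / L) +
        θ 2 * (Real.log (s * (n * m)) / L) ≤ k * h :=
      hcert.trans (mul_le_mul_of_nonneg_left hh (Nat.cast_nonneg k))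
    -- expand the logarithms
    have e1 : Real.log ((s : ℝ) * (n * m)) = Real.log s + Real.log n + Real.log m := by
      rw [Real.log_mul hs0.ne' (by positivity), Real.log_mul hn0.ne' hm0.ne']; ring
    have e2 : Real.log ((s : ℝ) * (n * n)) = Real.log s + Real.log n + Real.log n := by
      rw [Real.log_mul hs0.ne' (by positivity), Real.log_mul hn0.ne' hn0.ne']; ring
    rw [e1, e2] at hkh
    -- `X := log s + (1+θ₁) log n + (1−θ₁) log m ≤ k h L`
    have hX : Real.log s + (1 + θ 1) * Real.log n + (1 - θ 1) * Real.log m ≤ k * h * L := by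
      have hkh' := mul_le_mul_of_nonneg_right hkh hL0.le
      have hLne : L ≠ 0 := hL0.ne'
      have e : (θ 0 * ((Real.log s + Real.log n + Real.log m) / L) +
          θ 1 * ((Real.log s + Real.log n + Real.log n) / L) +
          θ 2 * ((Real.log s + Real.log n + Real.log m) / L)) * L =
          θ 0 * (Real.log s + Real.log n + Real.log m) + θ 1 * (Real.log s + Real.log n + Real.log n) +
          θ 2 * (Real.log s + Real.log n + Real.log m) := by
        field_simp
      rw [e] at hkh'
      have e' : θ 0 * (Real.log s + Real.log n + Real.log m) +
          θ 1 * (Real.log s + Real.log n + Real.log n) + θ 2 * (Real.log s + Real.log n + Real.log m) =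
          Real.log s + (1 + θ 1) * Real.log n + (1 - θ 1) * Real.log m := by
        linear_combination (Real.log s + Real.log n + Real.log m) * hsum
      linarith [hkh', e']
    -- the method's bound: `k log r − log s ≤ (ω + ε) log n`
    have hbd' : k * Real.log r - Real.log s ≤ (ω + ε) * Real.log n := by
      have := hbd
      rw [tMethodBound, div_le_iff₀ hlogn] at this
      exact this
    -- `k log r = ρ · (k h L) ≥ ρ X`
    have hkr : ρ * (Real.log s + (1 + θ 1) * Real.log n + (1 - θ 1) * Real.log m) ≤
        k * Real.log r := by
      have hρL : ρ * (h * L) = Real.log r := by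
        rw [hρ]
        field_simp
      calc ρ * (Real.log s + (1 + θ 1) * Real.log n + (1 - θ 1) * Real.log m)
          ≤ ρ * (k * h * L) := mul_le_mul_of_nonneg_left hX (by linarith)
        _ = k * (ρ * (h * L)) := by ring
        _ = k * Real.log r := by rw [hρL]
    -- `G := (1+θ₁) log n + (1−θ₁) log m ≥ 0`, and `(ω + ε) log n ≥ ρ G`
    have hG0 : 0 ≤ (1 + θ 1) * Real.log n + (1 - θ 1) * Real.log m := by
      have : 0 ≤ 1 + θ 1 := by linarith [hθ0 1]
      have : 0 ≤ 1 - θ 1 := by linarith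
      positivity
    have hstep : ρ * ((1 + θ 1) * Real.log n + (1 - θ 1) * Real.log m) ≤ (ω + ε) * Real.log n := by
      have h1 : Real.log s ≤ ρ * Real.log s := le_mul_of_one_le_left hlogs hρ1
      calc ρ * ((1 + θ 1) * Real.log n + (1 - θ 1) * Real.log m)
          = ρ * (Real.log s + (1 + θ 1) * Real.log n + (1 - θ 1) * Real.log m) - ρ * Real.log s := by
            ring
        _ ≤ k * Real.log r - ρ * Real.log s := by linarith only [hkr]
        _ ≤ k * Real.log r - Real.log s := by linarith only [h1]
        _ ≤ (ω + ε) * Real.log n := hbd'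
    -- compare with `F := (1+θ₁) + (1−θ₁)(p − ε)`
    have hGF : ((1 + θ 1) + (p - ε) * (1 - θ 1)) * Real.log n ≤
        (1 + θ 1) * Real.log n + (1 - θ 1) * Real.log m := by
      have : (1 - θ 1) * ((p - ε) * Real.log n) ≤ (1 - θ 1) * Real.log m :=
        mul_le_mul_of_nonneg_left hlogm (by linarith)
      linarith only [this]
    by_cases hF : 0 ≤ (1 + θ 1) + (p - ε) * (1 - θ 1)
    · -- `ρ₀ F ≤ ρ F ≤ ρ G / log n ≤ ω + ε`
      have h1 : ρ₀ * ((1 + θ 1) + (p - ε) * (1 - θ 1)) * Real.log n ≤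
          ρ * ((1 + θ 1) * Real.log n + (1 - θ 1) * Real.log m) := by
        calc ρ₀ * ((1 + θ 1) + (p - ε) * (1 - θ 1)) * Real.log n
            ≤ ρ * ((1 + θ 1) + (p - ε) * (1 - θ 1)) * Real.log n := by
              have := mul_le_mul_of_nonneg_right hρρ₀ hF
              exact mul_le_mul_of_nonneg_right this hlogn.le
          _ = ρ * (((1 + θ 1) + (p - ε) * (1 - θ 1)) * Real.log n) := by ring
          _ ≤ ρ * ((1 + θ 1) * Real.log n + (1 - θ 1) * Real.log m) :=
              mul_le_mul_of_nonneg_left hGF (by linarith)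
      have h2 := h1.trans hstep
      exact le_of_mul_le_mul_right h2 hlogn
    · -- `F < 0`: `ρ₀ F < 0 ≤ ω + ε`
      rw [not_le] at hF
      have h1 : ρ₀ * ((1 + θ 1) + (p - ε) * (1 - θ 1)) < 0 := mul_neg_of_pos_of_neg (by linarith) hF
      have h2 : 0 * Real.log n ≤ (ω + ε) * Real.log n := by
        rw [zero_mul]
        exact le_trans (mul_nonneg (by linarith) hG0) hstep
      have h3 : 0 ≤ ω + ε := le_of_mul_le_mul_right h2 hlogn
      linarith only [h1, h3]
  -- `ε → 0`
  refine le_of_forall_pos_lt_add fun δ hδ => ?_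
  have hρ₀0 : 0 ≤ ρ₀ := by linarith
  have he₃ : 0 ≤ 1 - θ 1 := by linarith
  have hc : 0 < 1 + ρ₀ * (1 - θ 1) := by positivity
  have hε : 0 < δ / (1 + ρ₀ * (1 - θ 1)) / 2 := by positivity
  have := main _ hε
  have hsplit : ρ₀ * ((1 + θ 1) + p * (1 - θ 1)) =
      ρ₀ * ((1 + θ 1) + (p - δ / (1 + ρ₀ * (1 - θ 1)) / 2) * (1 - θ 1)) +
        ρ₀ * (1 - θ 1) * (δ / (1 + ρ₀ * (1 - θ 1)) / 2) := by ring
  rw [hsplit]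
  have hbound : ρ₀ * (1 - θ 1) * (δ / (1 + ρ₀ * (1 - θ 1)) / 2) + δ / (1 + ρ₀ * (1 - θ 1)) / 2 =
      δ / 2 := by
    field_simp
    ring
  linarith only [this, hbound, hδ]

/-- **CLLZ Thm. 3.22 (§4.3) for `F = ζ^θ`, proved from a standard-basis certificate:** with
`θ ∈ P([3])`, `θ 1 < 1`, `H_θ(supp T) ≤ h`, `h > 0`, `2^h ≤ R₀ ≤ R̃(T)`, every `T`-method lower bound
`p` on `α` (`IsTMethodAlphaBound`, i.e. a `T`-method bound `2` on `ω(p)`) satisfies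
`p ≤ (2 h / log₂ R₀ − (1 + θ 1)) / (1 − θ 1)` (printed for `CW_q`:
`p ≤ 2 log₂ ζ^θ(CW_q) / (log₂ R̃(CW_q)(θ₂+θ₃)) − (2θ₁+θ₂+θ₃)/(θ₂+θ₃)`, with `log₂ ζ^θ(CW_q)` bounded by the
standard-basis program `max_P ∑ θᵢ H(Pᵢ)`). [cite: ChristandlLeGallLysikovZuiddam2025, Thm. 3.22 and §4.3] -/
theorem alpha_le_of_maxWeightedEntropy_le {T : ι → κ → μ → K} {θ : Fin 3 → ℝ}
    (hθ : θ ∈ stdSimplex ℝ (Fin 3)) (hθ1 : θ 1 < 1) {h R₀ : ℝ} (h0 : 0 < h)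
    (hh : maxWeightedEntropy θ (tensorSupport T) ≤ h) (hR₀ : (2 : ℝ) ^ h ≤ R₀)
    (hR : R₀ ≤ asymptoticRank T) {p : ℝ} (hb : IsTMethodAlphaBound K T p) :
    p ≤ (2 * h / Real.logb 2 R₀ - (1 + θ 1)) / (1 - θ 1) := by
  have hB := tMethodBound_ge_of_maxWeightedEntropy_le hθ h0 hh hR₀ hR hb
  have h2h : 1 < (2 : ℝ) ^ h := Real.one_lt_rpow one_lt_two h0
  have hR₀1 : 1 < R₀ := h2h.trans_le hR₀
  have hlog : 0 < Real.logb 2 R₀ := Real.logb_pos one_lt_two hR₀1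
  have hρ : 0 < Real.logb 2 R₀ / h := div_pos hlog h0
  have he₃ : 0 < 1 - θ 1 := by linarith
  rw [le_div_iff₀ he₃, le_sub_iff_add_le, le_div_iff₀ hlog]
  rw [div_mul_eq_mul_div, div_le_iff₀ h0] at hB
  linarith [hB]

end Chain

/-! ## Dual certificates for `CW_q` -/

section Cw

variable {K : Type} [Field K]

/-- The inline tensor of the facts of `RectangularBarrier.lean` is `CW_q = bigCwTensor K q`.
[cite: ChristandlLeGallLysikovZuiddam2025, §2] -/
theorem bigCwTensor_eq_inline (K : Type) [Field K] (q : ℕ) :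
    (fun a b c : Fin (q + 2) =>
      if (a = 0 ∧ b = c ∧ b ≠ 0 ∧ b ≠ Fin.last (q + 1)) ∨
          (b = 0 ∧ a = c ∧ a ≠ 0 ∧ a ≠ Fin.last (q + 1)) ∨
          (c = 0 ∧ a = b ∧ a ≠ 0 ∧ a ≠ Fin.last (q + 1)) ∨
          (a = 0 ∧ b = 0 ∧ c = Fin.last (q + 1)) ∨
          (a = 0 ∧ b = Fin.last (q + 1) ∧ c = 0) ∨
          (a = Fin.last (q + 1) ∧ b = 0 ∧ c = 0) then (1 : K) else 0) = bigCwTensor K q := rfl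

/-- A three-level vector on `{0, 1…q, q+1}`: value `α` at `0`, `γ` at `q+1`, `β` in the middle; its
total mass is `α + q β + γ`. [folklore] -/
theorem sum_threeLevel (q : ℕ) (α β γ : ℝ) :
    ∑ y : Fin (q + 2), (if y = 0 then α else if y = Fin.last (q + 1) then γ else β) = α + q * β + γ := by
  have hl : Fin.last (q + 1) ≠ 0 := by simp [Fin.ext_iff]
  rw [sum_univ_fin_add_two]
  simp only [hl, cwMid_ne_zero, cwMid_ne_last, Finset.sum_const, Finset.card_univ,
    Fintype.card_fin, nsmul_eq_mul, reduceIte]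
  ring

/-- **Weak duality on `supp CW_q`.** For `θ ≥ 0`, three positive three-level vectors
`Qᵢ = (αᵢ, βᵢ ×q, γᵢ)` with `αᵢ + q βᵢ + γᵢ ≤ 1`, and `V ≥ 0` dominating the six costs
`∑ᵢ θᵢ log₂(1/Qᵢ(xᵢ))` at the orbit types `(0,i,i), (i,0,i), (i,i,0), (0,0,q+1), (0,q+1,0), (q+1,0,0)`
of `supp CW_q`: `H_θ(supp CW_q) ≤ V` (CLLZ §4.3–4.4, the program `max_P ∑ θᵢ H(Pᵢ)` bounded by its
dual). [cite: ChristandlLeGallLysikovZuiddam2025, §4.4] -/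
theorem maxWeightedEntropy_bigCw_le_of_costs (q : ℕ) {θ : Fin 3 → ℝ} (hθ : ∀ i, 0 ≤ θ i)
    {α₁ β₁ γ₁ α₂ β₂ γ₂ α₃ β₃ γ₃ V : ℝ}
    (hα₁ : 0 < α₁) (hβ₁ : 0 < β₁) (hγ₁ : 0 < γ₁) (hα₂ : 0 < α₂) (hβ₂ : 0 < β₂) (hγ₂ : 0 < γ₂)
    (hα₃ : 0 < α₃) (hβ₃ : 0 < β₃) (hγ₃ : 0 < γ₃)
    (h₁ : α₁ + q * β₁ + γ₁ ≤ 1) (h₂ : α₂ + q * β₂ + γ₂ ≤ 1) (h₃ : α₃ + q * β₃ + γ₃ ≤ 1) (hV : 0 ≤ V)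
    (cA : θ 0 * (-Real.log α₁ / Real.log 2) + θ 1 * (-Real.log β₂ / Real.log 2) +
      θ 2 * (-Real.log β₃ / Real.log 2) ≤ V)
    (cB : θ 0 * (-Real.log β₁ / Real.log 2) + θ 1 * (-Real.log α₂ / Real.log 2) +
      θ 2 * (-Real.log β₃ / Real.log 2) ≤ V)
    (cC : θ 0 * (-Real.log β₁ / Real.log 2) + θ 1 * (-Real.log β₂ / Real.log 2) +
      θ 2 * (-Real.log α₃ / Real.log 2) ≤ V)
    (cD : θ 0 * (-Real.log α₁ / Real.log 2) + θ 1 * (-Real.log α₂ / Real.log 2) +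
      θ 2 * (-Real.log γ₃ / Real.log 2) ≤ V)
    (cE : θ 0 * (-Real.log α₁ / Real.log 2) + θ 1 * (-Real.log γ₂ / Real.log 2) +
      θ 2 * (-Real.log α₃ / Real.log 2) ≤ V)
    (cF : θ 0 * (-Real.log γ₁ / Real.log 2) + θ 1 * (-Real.log α₂ / Real.log 2) +
      θ 2 * (-Real.log α₃ / Real.log 2) ≤ V) :
    maxWeightedEntropy θ (tensorSupport (bigCwTensor K q)) ≤ V := by
  classical
  have hl : (0 : Fin (q + 2)) ≠ Fin.last (q + 1) := by
    rw [Ne, Fin.ext_iff]; simp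
  refine maxWeightedEntropy_le_of_cost_le hθ
    (Q₁ := fun y : Fin (q + 2) => if y = 0 then α₁ else if y = Fin.last (q + 1) then γ₁ else β₁)
    (Q₂ := fun y : Fin (q + 2) => if y = 0 then α₂ else if y = Fin.last (q + 1) then γ₂ else β₂)
    (Q₃ := fun y : Fin (q + 2) => if y = 0 then α₃ else if y = Fin.last (q + 1) then γ₃ else β₃)
    (fun y => by split_ifs <;> assumption) (by rw [sum_threeLevel]; exact h₁)
    (fun y => by split_ifs <;> assumption) (by rw [sum_threeLevel]; exact h₂)
    (fun y => by split_ifs <;> assumption) (by rw [sum_threeLevel]; exact h₃)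
    hV ?_
  rintro ⟨a, b, c⟩ hx
  rw [mem_tensorSupport] at hx
  simp only [bigCwTensor_apply, ne_eq, ite_eq_right_iff, one_ne_zero, imp_false, not_not] at hx
  dsimp only
  rcases hx with ⟨rfl, rfl, hb0, hbl⟩ | ⟨rfl, rfl, ha0, hal⟩ | ⟨rfl, rfl, ha0, hal⟩ |
    ⟨rfl, rfl, rfl⟩ | ⟨rfl, rfl, rfl⟩ | ⟨rfl, rfl, rfl⟩
  · simp only [if_true, hb0, hbl, if_false]; exact cA
  · simp only [if_true, ha0, hal, if_false]; exact cB
  · simp only [if_true, ha0, hal, if_false]; exact cC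
  · simp only [if_true, hl.symm, if_false]; exact cD
  · simp only [if_true, hl.symm, if_false]; exact cE
  · simp only [if_true, hl.symm, if_false]; exact cF

/-- **The `CW_q` barrier on `ω̂(p)` from a dual certificate** (CLLZ §4.4, eq. (5) with Table 1's
program): if the six costs of positive three-level vectors `Qᵢ` (masses `≤ 1`) are `≤ h`, where
`0 < h ≤ log₂(q+2)` and `θ ∈ P([3])`, then every `CW_q`-method bound `ω̂` on `ω(p)` satisfies
`ω̂ ≥ (log₂(q+2)/h)·((1 + θ 1) + p(1 − θ 1))` (`R̃(CW_q) ≥ q + 2` by the flattening rank).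
[cite: ChristandlLeGallLysikovZuiddam2025, §4.4] -/
theorem omegaHat_bigCw_ge_of_costs (q : ℕ) {θ : Fin 3 → ℝ} (hθ : θ ∈ stdSimplex ℝ (Fin 3))
    {α₁ β₁ γ₁ α₂ β₂ γ₂ α₃ β₃ γ₃ h : ℝ}
    (hα₁ : 0 < α₁) (hβ₁ : 0 < β₁) (hγ₁ : 0 < γ₁) (hα₂ : 0 < α₂) (hβ₂ : 0 < β₂) (hγ₂ : 0 < γ₂)
    (hα₃ : 0 < α₃) (hβ₃ : 0 < β₃) (hγ₃ : 0 < γ₃)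
    (h₁ : α₁ + q * β₁ + γ₁ ≤ 1) (h₂ : α₂ + q * β₂ + γ₂ ≤ 1) (h₃ : α₃ + q * β₃ + γ₃ ≤ 1)
    (h0 : 0 < h) (hL : h ≤ Real.logb 2 (q + 2))
    (cA : θ 0 * (-Real.log α₁ / Real.log 2) + θ 1 * (-Real.log β₂ / Real.log 2) +
      θ 2 * (-Real.log β₃ / Real.log 2) ≤ h)
    (cB : θ 0 * (-Real.log β₁ / Real.log 2) + θ 1 * (-Real.log α₂ / Real.log 2) +
      θ 2 * (-Real.log β₃ / Real.log 2) ≤ h)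
    (cC : θ 0 * (-Real.log β₁ / Real.log 2) + θ 1 * (-Real.log β₂ / Real.log 2) +
      θ 2 * (-Real.log α₃ / Real.log 2) ≤ h)
    (cD : θ 0 * (-Real.log α₁ / Real.log 2) + θ 1 * (-Real.log α₂ / Real.log 2) +
      θ 2 * (-Real.log γ₃ / Real.log 2) ≤ h)
    (cE : θ 0 * (-Real.log α₁ / Real.log 2) + θ 1 * (-Real.log γ₂ / Real.log 2) +
      θ 2 * (-Real.log α₃ / Real.log 2) ≤ h)
    (cF : θ 0 * (-Real.log γ₁ / Real.log 2) + θ 1 * (-Real.log α₂ / Real.log 2) +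
      θ 2 * (-Real.log α₃ / Real.log 2) ≤ h)
    {p ω : ℝ} (hb : IsTMethodBound K (bigCwTensor K q) p ω) :
    Real.logb 2 (q + 2) / h * ((1 + θ 1) + p * (1 - θ 1)) ≤ ω := by
  classical
  have hq2 : (0 : ℝ) < q + 2 := by positivity
  have hR₀ : (2 : ℝ) ^ h ≤ q + 2 := by
    calc (2 : ℝ) ^ h ≤ (2 : ℝ) ^ Real.logb 2 (q + 2) := Real.rpow_le_rpow_of_exponent_le one_le_two hL
      _ = q + 2 := Real.rpow_logb two_pos (by norm_num) hq2
  exact tMethodBound_ge_of_maxWeightedEntropy_le hθ h0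
    (maxWeightedEntropy_bigCw_le_of_costs q hθ.1 hα₁ hβ₁ hγ₁ hα₂ hβ₂ hγ₂ hα₃ hβ₃ hγ₃ h₁ h₂ h₃ h0.le
      cA cB cC cD cE cF) hR₀ (le_asymptoticRank_bigCwTensor (K := K) q) hb

/-- **The `CW_q` barrier on `α` from a dual certificate** (CLLZ Thm. 3.22 with §4.3): under the same
hypotheses and `θ 1 < 1`, every `CW_q`-method lower bound `p` on `α` satisfies
`p ≤ (2h / log₂(q+2) − (1 + θ 1)) / (1 − θ 1)`. [cite: ChristandlLeGallLysikovZuiddam2025, §4.3] -/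
theorem alpha_bigCw_le_of_costs (q : ℕ) {θ : Fin 3 → ℝ} (hθ : θ ∈ stdSimplex ℝ (Fin 3))
    (hθ1 : θ 1 < 1) {α₁ β₁ γ₁ α₂ β₂ γ₂ α₃ β₃ γ₃ h : ℝ}
    (hα₁ : 0 < α₁) (hβ₁ : 0 < β₁) (hγ₁ : 0 < γ₁) (hα₂ : 0 < α₂) (hβ₂ : 0 < β₂) (hγ₂ : 0 < γ₂)
    (hα₃ : 0 < α₃) (hβ₃ : 0 < β₃) (hγ₃ : 0 < γ₃)
    (h₁ : α₁ + q * β₁ + γ₁ ≤ 1) (h₂ : α₂ + q * β₂ + γ₂ ≤ 1) (h₃ : α₃ + q * β₃ + γ₃ ≤ 1)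
    (h0 : 0 < h) (hL : h ≤ Real.logb 2 (q + 2))
    (cA : θ 0 * (-Real.log α₁ / Real.log 2) + θ 1 * (-Real.log β₂ / Real.log 2) +
      θ 2 * (-Real.log β₃ / Real.log 2) ≤ h)
    (cB : θ 0 * (-Real.log β₁ / Real.log 2) + θ 1 * (-Real.log α₂ / Real.log 2) +
      θ 2 * (-Real.log β₃ / Real.log 2) ≤ h)
    (cC : θ 0 * (-Real.log β₁ / Real.log 2) + θ 1 * (-Real.log β₂ / Real.log 2) +
      θ 2 * (-Real.log α₃ / Real.log 2) ≤ h)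
    (cD : θ 0 * (-Real.log α₁ / Real.log 2) + θ 1 * (-Real.log α₂ / Real.log 2) +
      θ 2 * (-Real.log γ₃ / Real.log 2) ≤ h)
    (cE : θ 0 * (-Real.log α₁ / Real.log 2) + θ 1 * (-Real.log γ₂ / Real.log 2) +
      θ 2 * (-Real.log α₃ / Real.log 2) ≤ h)
    (cF : θ 0 * (-Real.log γ₁ / Real.log 2) + θ 1 * (-Real.log α₂ / Real.log 2) +
      θ 2 * (-Real.log α₃ / Real.log 2) ≤ h)
    {p : ℝ} (hb : IsTMethodAlphaBound K (bigCwTensor K q) p) :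
    p ≤ (2 * h / Real.logb 2 (q + 2) - (1 + θ 1)) / (1 - θ 1) := by
  classical
  have hq2 : (0 : ℝ) < q + 2 := by positivity
  have hR₀ : (2 : ℝ) ^ h ≤ q + 2 := by
    calc (2 : ℝ) ^ h ≤ (2 : ℝ) ^ Real.logb 2 (q + 2) := Real.rpow_le_rpow_of_exponent_le one_le_two hL
      _ = q + 2 := Real.rpow_logb two_pos (by norm_num) hq2
  exact alpha_le_of_maxWeightedEntropy_le hθ hθ1 h0
    (maxWeightedEntropy_bigCw_le_of_costs q hθ.1 hα₁ hβ₁ hγ₁ hα₂ hβ₂ hγ₂ hα₃ hβ₃ hγ₃ h₁ h₂ h₃ h0.le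
      cA cB cC cD cE cF) hR₀ (le_asymptoticRank_bigCwTensor (K := K) q) hb

end Cw

end Literature.Barriers.MatrixMultiplication

end
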